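import Summits.QuantumFields.YangMills.Theorems.UnitScaleTiltProp7CurrentPairingBound
import HarnessLib

/-!
# Route `UnitScaleTilt`, crux K1 «MinimiserStabilityRegPr» (stmt-QuantumFields-19200), route-R E′ growth side, ℛ-line, J-ROW★ curved — brick B-J2 «LEIBNIZ FOR THE COVARIANT
# DERIVATIVE OF THE CURRENT FIELD»: the tree's CURRENT term is a conjugation defect of ONE transported value, `CURRENT_{νμ}(x) = g⁰_μ(x) − R(V_{νμ}(x))g⁰_μ(x)` with
# `g⁰_μ(x) = R(U_μ(x))φ(x+e_μ)` and `‖V_{νμ}(x) − 1‖ ≤ ‖(D^*_ν U(∂p_{νμ}))(x)‖` (one summand of the E–L current); hence `D_κ C_μ = LIVE − MAIN` EXACTLY for the current field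
# `C_μ = Σ_ν CURRENT_{νμ}`, and `|D_κ C_μ + MAIN|²_HS ≤ 8d²J²·(|D_κφ(x+e_μ)|² + |curl_U D_Uφ(p_{κμ}(x))|²)` — every term live; `MAIN` (one principal term) is what B-J3 must bound

Cell `ym3-torus`, width seat `ym3-torus-px12` (gen 5); LOCATE «B-J2» (HOME `ym3-torus-px12/g5/LOCATE-BJ2-px12g5.md`) of w4 g7's LOCATE v4.2 §5 (HOME
`ym-ust-19200-w4/g7/LOCATE-JROW-CURVED-V4-w4g7.md`).  WHERE IT SITS: B-J5 reads ✓ `Prop7CurrentPairingBound.current_pairing_le` with the test field `B := C` (the current field) and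
needs `Σ|curl_U C|² ≤ (c∕ℓ²)·CUR + live`; this file reduces `D_κ C_μ` (hence `curl_U C`) to ONE principal term `MAIN_{κμ}` plus errors booked in the E′ currencies `M(φ)`, `K(φ)` times
`J²`, `J` a PER-SUMMAND bound on the plaquette field's covariant codifferences (`J := 2a` from PlaqSmall alone at the member, `a = ε₀ℓ⁻²` — routeR-w4 g12's second read;
the ν-SUM is DivSmall's `O(ε₀ℓ⁻³)` object); B-J3 (covariant tent `J = Q_U^*λ` + ✓B-J1) bounds `MAIN`.
THEOREMS ONLY (0 `def`, 0 `sorry`); `--supports stmt-QuantumFields-19200`, count-neutral.  YM₃ on T³ is a ladder rung (R3), not the Clay problem; nothing here claims J-ROW★, hKg-K,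
S3, E′, a stub, the crux, d = 4 or the mass gap.

WHAT IS PROVED (ns `…Theorems.Prop7CurrentFieldLeibniz`; letters of ✓p684887∕✓p685538: the CURRENT term, `K(φ)`, `M(φ)` VERBATIM; `B9Eq39Adjoint`: `R covD covDstar curl plaqU`).
* §1 (any ring) ★ `R_sub_self_eq_comm_mul` (`R(W)X − X = (WX − XW)·W⁻¹`: commutator currency is exact), ★ `covD_sub_conj_eq` (LEIBNIZ: `D_κ(X − R(V)X) = (d − R(V⁺)d) − (R(V⁺)X − R(V)X)`,
  `d = D_κX`, `V⁺ = U_κ(x)V(x+e_κ)U_κ(x)⁻¹`), `R_mul_inv_R`; the ratio form `R(V⁺)X − R(V)X = R(V)(R(V⁻¹V⁺)X − X)` is ✓ `Prop7CoCurlOfCurvatureCommutator.R_sub_R_eq`.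
* §2 (torus, unitary `M_N(ℂ)` background) ★ `transport_mul_eq` (`P̃·S = U_μ(x)`), ★★ `current_term_eq` (`CURRENT_{νμ}(x) = g⁰ − R(V)g⁰`), ★ `coe_V_sub_one_eq` ∕ `norm_V_sub_one_le` ∕ `V_mem_unitary`.
* §3 ★ `covD_transportedValue_eq` (`D_κg⁰_μ(x) = R(U_μ(x))(D_κφ)(x+e_μ) + curl_U(D_Uφ)_{κμ}(x)`, exact), ★★ `covD_currentField_eq` (`D_κ C_μ = LIVE − MAIN`, exact).
* §4 ★ `sum_norm_sq_R_sub_self_le` (`|R(W)Z − Z|²_HS ≤ 4‖W−1‖²|Z|²_HS`), `sum_norm_sq_sum_le` (Cauchy–Schwarz over `ν`), ★★★ `sum_norm_sq_covD_currentField_add_main_le` (POINTWISE B-J2).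
  The torus-summed form (`≤ 8d²J²(d·M + 2K)`) and the curl form B-J5 reads are in the sequel `…Prop7CurrentFieldCurlSum`.
HONEST SCOPE.  Exact lattice algebra + Hilbert–Schmidt triangle inequalities, crude constants; `MAIN` is DISPLAYED for B-J3; no estimate of Bałaban's is asserted.

References: T. Bałaban, CMP 99 (1985) 389–434 [Balaban1985BackgroundPropagators] ((3.3)–(3.4) pp.390–391, (3.8)–(3.9) p.392); CMP 102 (1985) 277–309 [Balaban1985Variational]
((135) p.298, Prop. 7 p.299); CMP 99 (1985) 75–102 [Balaban1985RegularSpaces] ((1.2) p.76, (1.9) p.77).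
-/

set_option autoImplicit false

noncomputable section

open scoped BigOperators Matrix.Norms.L2Operator Matrix

namespace Summit.QuantumFields.YangMills.Theorems.Prop7CurrentFieldLeibniz

open Literature.MathematicalPhysics.QuantumFieldTheory.Balaban1983to89
open B9Eq39Adjoint (R R_def R_add R_sub R_neg R_inv_R R_R_inv covD covDstar curl plaqU curl_swap curl_self)
open B9TorusCalculus (torusT torusT_apply torusT_symm_apply torusT_comm)
open B11Eq135Weitzenbock (norm_R_sub_self_le R_finset_sum covD_finset_sum)
open Summit.QuantumFields.YangMills.Theorems.Prop7CovariantCurlOfGrad (curl_covD_eq)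
open Summit.QuantumFields.YangMills.Theorems.Prop7CovariantCoercivity (sum_norm_sq_add_le sum_norm_sq_mul_le sum_norm_sq_mul_le' sum_norm_sq_R coe_inv_eq_star inv_mem_unitary)
open Summit.QuantumFields.YangMills.Theorems.Prop7RRowOfJRow (shift_unshift shift_shift_unshift)

/-! ## §1 Ring level: commutator currency and Leibniz for a conjugation defect -/

section RingLevel

variable {𝔸 : Type*} [Ring 𝔸] {S : Type*} {ι : Type*} (T : ι → Equiv.Perm S) (U : ι → S → 𝔸ˣ)

/-- ★ **COMMUTATOR CURRENCY IS EXACT**: `R(W)X − X = (WX − XW)·W⁻¹` — a conjugation defect is a commutator times a unit. [folklore] [cite: Balaban1985Variational, (135) p.298] -/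
theorem R_sub_self_eq_comm_mul (W : 𝔸ˣ) (X : 𝔸) : R W X - X = ((W : 𝔸) * X - X * W) * ((W⁻¹ : 𝔸ˣ) : 𝔸) := by
  rw [R_def, sub_mul, mul_assoc X, Units.mul_inv, mul_one]

/-- ★ **LEIBNIZ FOR THE COVARIANT DERIVATIVE OF A CONJUGATION DEFECT**: for site fields `X : S → 𝔸`, `V : S → 𝔸ˣ` and a direction `κ`,
`D_κ(X − R(V)X)(x) = (d − R(V⁺)d) − (R(V⁺)X(x) − R(V(x))X(x))` with `d = (D_κX)(x)`, `V⁺ = U_κ(x)·V(x+e_κ)·U_κ(x)⁻¹` (the unit at `x + e_κ` transported to `x`): the transported unit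
defect acts on the covariant DIFFERENCE of `X`, and the DIFFERENCE of the two units acts on the value `X(x)` (commutator currency: `R(V⁺)X − R(V)X = R(V)(R(V⁻¹V⁺)X − X)`, ✓ `Prop7CoCurlOfCurvatureCommutator.R_sub_R_eq`).
[folklore] [cite: Balaban1985BackgroundPropagators, (3.8) p.392] -/
theorem covD_sub_conj_eq (X : S → 𝔸) (V : S → 𝔸ˣ) (κ : ι) (x : S) :
    covD T U κ (fun z => X z - R (V z) (X z)) x
      = (covD T U κ X x - R (U κ x * V (T κ x) * (U κ x)⁻¹) (covD T U κ X x))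
        - (R (U κ x * V (T κ x) * (U κ x)⁻¹) (X x) - R (V x) (X x)) := by
  simp only [covD, R_sub, B9Eq39Adjoint.R_mul, R_inv_R]
  abel

/-- `R(AB⁻¹)R(B)Z = R(A)Z`. [folklore] -/
theorem R_mul_inv_R (A B : 𝔸ˣ) (Z : 𝔸) : R (A * B⁻¹) (R B Z) = R A Z := by
  rw [B9Eq39Adjoint.R_mul, R_inv_R]

end RingLevel

/-! ## §2 Torus letters: the CURRENT term is a conjugation defect of one transported value -/

variable {P : Params} {i : ℕ} {N : ℕ} (U : Fin P.d → Site P i → (Matrix (Fin N) (Fin N) ℂ)ˣ)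

/-- ★ **THE TRANSPORT IDENTITY**: with `y = x − e_ν`, `P̃ = U_ν(y)⁻¹·U(∂p_{νμ}(y))·U_ν(y)` (the plaquette at `y` transported to `x`) and `S = U_ν(y)⁻¹U_μ(y)U_ν(y+e_μ)` (the lower staple),
`P̃·S = U_μ(x)`. [folklore] [cite: Balaban1985BackgroundPropagators, (3.1) p.390] -/
theorem transport_mul_eq (μ ν : Fin P.d) (x : Site P i) :
    ((U ν (x.unshift ν))⁻¹ * plaqU (torusT P i) U ν μ (x.unshift ν) * U ν (x.unshift ν))
        * ((U ν (x.unshift ν))⁻¹ * (U μ (x.unshift ν) * U ν ((x.unshift ν).shift μ))) = U μ x := by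
  simp only [plaqU, torusT_apply, shift_unshift, mul_assoc, inv_mul_cancel_left, mul_inv_cancel_left, inv_mul_cancel, mul_one]

/-- ★★ **THE CURRENT TERM IS A CONJUGATION DEFECT OF ONE TRANSPORTED VALUE**: the tree's CURRENT summand (✓ `sum_re_trace_curl_mul_curl_covD_eq_current_add_curv`, VERBATIM) equals
`g⁰ − R(V)g⁰` with `g⁰ = R(U_μ(x))φ(x+e_μ)` (INDEPENDENT of `ν`) and `V = U(∂p_{νμ}(x))·P̃⁻¹`. [cite: Balaban1985BackgroundPropagators, (3.8)-(3.9) p.392] -/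
theorem current_term_eq (φ : Site P i → Matrix (Fin N) (Fin N) ℂ) (μ ν : Fin P.d) (x : Site P i) :
    R ((U ν (x.unshift ν))⁻¹ * plaqU (torusT P i) U ν μ (x.unshift ν) * U ν (x.unshift ν))
          (R (U ν (x.unshift ν))⁻¹ (R (U μ (x.unshift ν) * U ν ((x.unshift ν).shift μ)) (φ (((x.unshift ν).shift μ).shift ν))))
      - R (plaqU (torusT P i) U ν μ x)
          (R (U ν (x.unshift ν))⁻¹ (R (U μ (x.unshift ν) * U ν ((x.unshift ν).shift μ)) (φ (((x.unshift ν).shift μ).shift ν))))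
      = R (U μ x) (φ (x.shift μ))
        - R (plaqU (torusT P i) U ν μ x * ((U ν (x.unshift ν))⁻¹ * plaqU (torusT P i) U ν μ (x.unshift ν) * U ν (x.unshift ν))⁻¹)
            (R (U μ x) (φ (x.shift μ))) := by
  rw [shift_shift_unshift]
  have e1 : R ((U ν (x.unshift ν))⁻¹ * plaqU (torusT P i) U ν μ (x.unshift ν) * U ν (x.unshift ν))
      (R (U ν (x.unshift ν))⁻¹ (R (U μ (x.unshift ν) * U ν ((x.unshift ν).shift μ)) (φ (x.shift μ)))) = R (U μ x) (φ (x.shift μ)) := by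
    rw [← transport_mul_eq U μ ν x]
    simp only [B9Eq39Adjoint.R_mul]
  rw [← e1, R_mul_inv_R]

/-- ★ **THE UNIT OF THE CURRENT TERM, MINUS ONE**: `V − 1 = −(D^*_ν F_{νμ})(x)·P̃⁻¹` with `F_{νμ} = U(∂p_{νμ}(·))` as matrices — the plaquette field's covariant codifference in
direction `ν` (ONE summand of the E–L current `D^*F`). [cite: Balaban1985BackgroundPropagators, (3.8) p.392; Balaban1985RegularSpaces, (1.2) p.76] -/
theorem coe_V_sub_one_eq (μ ν : Fin P.d) (x : Site P i) :
    ((plaqU (torusT P i) U ν μ x * ((U ν (x.unshift ν))⁻¹ * plaqU (torusT P i) U ν μ (x.unshift ν) * U ν (x.unshift ν))⁻¹ :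
        (Matrix (Fin N) (Fin N) ℂ)ˣ) : Matrix (Fin N) (Fin N) ℂ) - 1
      = -(covDstar (torusT P i) U ν (fun z => (plaqU (torusT P i) U ν μ z : Matrix (Fin N) (Fin N) ℂ)) x)
          * ((((U ν (x.unshift ν))⁻¹ * plaqU (torusT P i) U ν μ (x.unshift ν) * U ν (x.unshift ν))⁻¹ : (Matrix (Fin N) (Fin N) ℂ)ˣ) :
              Matrix (Fin N) (Fin N) ℂ) := by
  set Pt : (Matrix (Fin N) (Fin N) ℂ)ˣ := (U ν (x.unshift ν))⁻¹ * plaqU (torusT P i) U ν μ (x.unshift ν) * U ν (x.unshift ν) with hPt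
  have hcd : covDstar (torusT P i) U ν (fun z => (plaqU (torusT P i) U ν μ z : Matrix (Fin N) (Fin N) ℂ)) x
      = (Pt : Matrix (Fin N) (Fin N) ℂ) - plaqU (torusT P i) U ν μ x := by
    simp only [covDstar, torusT_symm_apply, hPt, R_def, Units.val_mul, inv_inv]
  rw [hcd, Units.val_mul, neg_mul, sub_mul, Units.mul_inv]
  abel

/-- ★ for a unitary background, `‖V − 1‖ ≤ ‖(D^*_ν F_{νμ})(x)‖`. [cite: Balaban1985RegularSpaces, (1.9) p.77] -/
theorem norm_V_sub_one_le [NeZero N] (hU : ∀ (ν : Fin P.d) (x : Site P i), (U ν x : Matrix (Fin N) (Fin N) ℂ) ∈ unitary (Matrix (Fin N) (Fin N) ℂ))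
    (μ ν : Fin P.d) (x : Site P i) :
    ‖((plaqU (torusT P i) U ν μ x * ((U ν (x.unshift ν))⁻¹ * plaqU (torusT P i) U ν μ (x.unshift ν) * U ν (x.unshift ν))⁻¹ :
        (Matrix (Fin N) (Fin N) ℂ)ˣ) : Matrix (Fin N) (Fin N) ℂ) - 1‖
      ≤ ‖covDstar (torusT P i) U ν (fun z => (plaqU (torusT P i) U ν μ z : Matrix (Fin N) (Fin N) ℂ)) x‖ := by
  letI : CStarAlgebra (Matrix (Fin N) (Fin N) ℂ) := B10Eq29TubeLine.cstarAlgebraMatrix N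
  rw [coe_V_sub_one_eq, neg_mul, norm_neg]
  refine (norm_mul_le _ _).trans ?_
  have hu : ((((U ν (x.unshift ν))⁻¹ * plaqU (torusT P i) U ν μ (x.unshift ν) * U ν (x.unshift ν))⁻¹ : (Matrix (Fin N) (Fin N) ℂ)ˣ) :
      Matrix (Fin N) (Fin N) ℂ) ∈ unitary (Matrix (Fin N) (Fin N) ℂ) := by
    refine inv_mem_unitary ?_
    simp only [Units.val_mul, plaqU]
    exact mul_mem (mul_mem (inv_mem_unitary (hU _ _)) (mul_mem (mul_mem (mul_mem (hU _ _) (hU _ _)) (inv_mem_unitary (hU _ _)))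
      (inv_mem_unitary (hU _ _)))) (hU _ _)
  have h1 : ‖((((U ν (x.unshift ν))⁻¹ * plaqU (torusT P i) U ν μ (x.unshift ν) * U ν (x.unshift ν))⁻¹ : (Matrix (Fin N) (Fin N) ℂ)ˣ) :
      Matrix (Fin N) (Fin N) ℂ)‖ ≤ 1 := (CStarRing.norm_of_mem_unitary hu).le
  calc _ ≤ ‖covDstar (torusT P i) U ν (fun z => (plaqU (torusT P i) U ν μ z : Matrix (Fin N) (Fin N) ℂ)) x‖ * 1 :=
        mul_le_mul_of_nonneg_left h1 (norm_nonneg _)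
    _ = _ := mul_one _

/-- the unit of the current term is unitary. [folklore] -/
theorem V_mem_unitary (hU : ∀ (ν : Fin P.d) (x : Site P i), (U ν x : Matrix (Fin N) (Fin N) ℂ) ∈ unitary (Matrix (Fin N) (Fin N) ℂ))
    (μ ν : Fin P.d) (x : Site P i) :
    ((plaqU (torusT P i) U ν μ x * ((U ν (x.unshift ν))⁻¹ * plaqU (torusT P i) U ν μ (x.unshift ν) * U ν (x.unshift ν))⁻¹ :
        (Matrix (Fin N) (Fin N) ℂ)ˣ) : Matrix (Fin N) (Fin N) ℂ) ∈ unitary (Matrix (Fin N) (Fin N) ℂ) := by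
  simp only [Units.val_mul, plaqU]
  refine mul_mem (mul_mem (mul_mem (mul_mem (hU _ _) (hU _ _)) (inv_mem_unitary (hU _ _))) (inv_mem_unitary (hU _ _))) (inv_mem_unitary ?_)
  simp only [Units.val_mul]
  exact mul_mem (mul_mem (inv_mem_unitary (hU _ _)) (mul_mem (mul_mem (mul_mem (hU _ _) (hU _ _)) (inv_mem_unitary (hU _ _)))
    (inv_mem_unitary (hU _ _)))) (hU _ _)


/-! ## §3 The covariant derivative of the transported value and of the current field, exactly -/

/-- ★ **THE COVARIANT DERIVATIVE OF THE TRANSPORTED VALUE**: for `g⁰_μ(z) = R(U_μ(z))φ(z+e_μ)`,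
`(D_κ g⁰_μ)(x) = R(U_μ(x))·(D_κφ)(x+e_μ) + curl_U(D_Uφ)_{κμ}(x)` — EXACT (✓ `curl_covD_eq` read backwards; no commutation of shifts is used): a transported covariant difference of `φ`
plus a curvature commutator, NO value of `φ`. [cite: Balaban1985BackgroundPropagators, (3.3)-(3.4) pp.390-391] -/
theorem covD_transportedValue_eq (φ : Site P i → Matrix (Fin N) (Fin N) ℂ) (μ κ : Fin P.d) (x : Site P i) :
    covD (torusT P i) U κ (fun z => R (U μ z) (φ (z.shift μ))) x
      = R (U μ x) (covD (torusT P i) U κ φ (x.shift μ)) + curl (torusT P i) U (fun κ' => covD (torusT P i) U κ' φ) κ μ x := by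
  rw [curl_covD_eq]
  simp only [covD, torusT_apply, R_sub, B9Eq39Adjoint.R_mul]
  abel

/-- ★★ **LEIBNIZ FOR THE CURRENT FIELD, EXACT**: with `C_μ(z) := Σ_ν CURRENT_{νμ}(z)` (the tree's CURRENT summand VERBATIM), `g⁰ = R(U_μ(x))φ(x+e_μ)`, `d = (D_κg⁰_μ)(x)`,
`V_ν(z) = U(∂p_{νμ}(z))·P̃_ν(z)⁻¹` and `V_ν⁺ = U_κ(x)V_ν(x+e_κ)U_κ(x)⁻¹`:  `(D_κ C_μ)(x) = Σ_ν (d − R(V_ν⁺)d) − Σ_ν (R(V_ν⁺)g⁰ − R(V_ν(x))g⁰)` =: `LIVE − MAIN`.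
[cite: Balaban1985BackgroundPropagators, (3.8)-(3.9) p.392; Balaban1985Variational, (135) p.298] -/
theorem covD_currentField_eq (φ : Site P i → Matrix (Fin N) (Fin N) ℂ) (μ κ : Fin P.d) (x : Site P i) :
    covD (torusT P i) U κ (fun z => ∑ ν : Fin P.d,
        (R ((U ν (z.unshift ν))⁻¹ * plaqU (torusT P i) U ν μ (z.unshift ν) * U ν (z.unshift ν))
              (R (U ν (z.unshift ν))⁻¹ (R (U μ (z.unshift ν) * U ν ((z.unshift ν).shift μ)) (φ (((z.unshift ν).shift μ).shift ν))))
          - R (plaqU (torusT P i) U ν μ z)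
              (R (U ν (z.unshift ν))⁻¹ (R (U μ (z.unshift ν) * U ν ((z.unshift ν).shift μ)) (φ (((z.unshift ν).shift μ).shift ν)))))) x
      = (∑ ν : Fin P.d,
          (covD (torusT P i) U κ (fun z => R (U μ z) (φ (z.shift μ))) x
            - R (U κ x * (plaqU (torusT P i) U ν μ (x.shift κ)
                  * ((U ν ((x.shift κ).unshift ν))⁻¹ * plaqU (torusT P i) U ν μ ((x.shift κ).unshift ν) * U ν ((x.shift κ).unshift ν))⁻¹) * (U κ x)⁻¹)
                (covD (torusT P i) U κ (fun z => R (U μ z) (φ (z.shift μ))) x)))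
        - ∑ ν : Fin P.d,
          (R (U κ x * (plaqU (torusT P i) U ν μ (x.shift κ)
                  * ((U ν ((x.shift κ).unshift ν))⁻¹ * plaqU (torusT P i) U ν μ ((x.shift κ).unshift ν) * U ν ((x.shift κ).unshift ν))⁻¹) * (U κ x)⁻¹)
                (R (U μ x) (φ (x.shift μ)))
            - R (plaqU (torusT P i) U ν μ x * ((U ν (x.unshift ν))⁻¹ * plaqU (torusT P i) U ν μ (x.unshift ν) * U ν (x.unshift ν))⁻¹)
                (R (U μ x) (φ (x.shift μ)))) := by
  have hfun : (fun z => ∑ ν : Fin P.d,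
        (R ((U ν (z.unshift ν))⁻¹ * plaqU (torusT P i) U ν μ (z.unshift ν) * U ν (z.unshift ν))
              (R (U ν (z.unshift ν))⁻¹ (R (U μ (z.unshift ν) * U ν ((z.unshift ν).shift μ)) (φ (((z.unshift ν).shift μ).shift ν))))
          - R (plaqU (torusT P i) U ν μ z)
              (R (U ν (z.unshift ν))⁻¹ (R (U μ (z.unshift ν) * U ν ((z.unshift ν).shift μ)) (φ (((z.unshift ν).shift μ).shift ν))))))
      = fun z => ∑ ν : Fin P.d, (R (U μ z) (φ (z.shift μ))
          - R (plaqU (torusT P i) U ν μ z * ((U ν (z.unshift ν))⁻¹ * plaqU (torusT P i) U ν μ (z.unshift ν) * U ν (z.unshift ν))⁻¹)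
              (R (U μ z) (φ (z.shift μ)))) := by
    funext z
    exact Finset.sum_congr rfl fun ν _ => current_term_eq U φ μ ν z
  rw [hfun, covD_finset_sum, ← Finset.sum_sub_distrib]
  refine Finset.sum_congr rfl fun ν _ => ?_
  exact covD_sub_conj_eq (torusT P i) U (fun z => R (U μ z) (φ (z.shift μ)))
    (fun z => plaqU (torusT P i) U ν μ z * ((U ν (z.unshift ν))⁻¹ * plaqU (torusT P i) U ν μ (z.unshift ν) * U ν (z.unshift ν))⁻¹) κ x

/-! ## §4 Hilbert–Schmidt bounds: every error term is live -/

/-- ★ **HILBERT–SCHMIDT SIZE OF A CONJUGATION DEFECT**: for unitary `W`, `Σ_jk|(R(W)Z − Z)_jk|² ≤ 4‖W − 1‖²·Σ_jk|Z_jk|²` (`R(W)Z − Z = ((W−1)Z − Z(W−1))·W⁻¹`).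
[folklore] [cite: Balaban1985Variational, (135) p.298] -/
theorem sum_norm_sq_R_sub_self_le [NeZero N] {W : (Matrix (Fin N) (Fin N) ℂ)ˣ} (hW : (W : Matrix (Fin N) (Fin N) ℂ) ∈ unitary (Matrix (Fin N) (Fin N) ℂ))
    (Z : Matrix (Fin N) (Fin N) ℂ) :
    ∑ j : Fin N, ∑ k : Fin N, ‖(R W Z - Z) j k‖ ^ 2 ≤ 4 * ‖(W : Matrix (Fin N) (Fin N) ℂ) - 1‖ ^ 2 * ∑ j : Fin N, ∑ k : Fin N, ‖Z j k‖ ^ 2 := by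
  letI : CStarAlgebra (Matrix (Fin N) (Fin N) ℂ) := B10Eq29TubeLine.cstarAlgebraMatrix N
  have hWi : ‖((W⁻¹ : (Matrix (Fin N) (Fin N) ℂ)ˣ) : Matrix (Fin N) (Fin N) ℂ)‖ ≤ 1 := (CStarRing.norm_of_mem_unitary (inv_mem_unitary hW)).le
  have e : R W Z - Z = (((W : Matrix (Fin N) (Fin N) ℂ) - 1) * Z + -(Z * ((W : Matrix (Fin N) (Fin N) ℂ) - 1))) * ((W⁻¹ : (Matrix (Fin N) (Fin N) ℂ)ˣ) : Matrix (Fin N) (Fin N) ℂ) := by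
    rw [R_sub_self_eq_comm_mul]; congr 1; noncomm_ring
  rw [e]
  have h0 : 0 ≤ ∑ j : Fin N, ∑ k : Fin N, ‖Z j k‖ ^ 2 := Finset.sum_nonneg fun _ _ => Finset.sum_nonneg fun _ _ => sq_nonneg _
  have h1 := sum_norm_sq_mul_le' (((W : Matrix (Fin N) (Fin N) ℂ) - 1) * Z + -(Z * ((W : Matrix (Fin N) (Fin N) ℂ) - 1)))
    ((W⁻¹ : (Matrix (Fin N) (Fin N) ℂ)ˣ) : Matrix (Fin N) (Fin N) ℂ)
  have h2 := sum_norm_sq_add_le (((W : Matrix (Fin N) (Fin N) ℂ) - 1) * Z) (-(Z * ((W : Matrix (Fin N) (Fin N) ℂ) - 1)))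
  have h3 := sum_norm_sq_mul_le ((W : Matrix (Fin N) (Fin N) ℂ) - 1) Z
  have h4 := sum_norm_sq_mul_le' Z ((W : Matrix (Fin N) (Fin N) ℂ) - 1)
  have hneg : ∑ j : Fin N, ∑ k : Fin N, ‖(-(Z * ((W : Matrix (Fin N) (Fin N) ℂ) - 1))) j k‖ ^ 2
      = ∑ j : Fin N, ∑ k : Fin N, ‖(Z * ((W : Matrix (Fin N) (Fin N) ℂ) - 1)) j k‖ ^ 2 := by
    simp only [Matrix.neg_apply, norm_neg]
  rw [hneg] at h2
  have h5 : 0 ≤ ∑ j : Fin N, ∑ k : Fin N, ‖((((W : Matrix (Fin N) (Fin N) ℂ) - 1) * Z + -(Z * ((W : Matrix (Fin N) (Fin N) ℂ) - 1)))) j k‖ ^ 2 :=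
    Finset.sum_nonneg fun _ _ => Finset.sum_nonneg fun _ _ => sq_nonneg _
  have hWi2 : ‖((W⁻¹ : (Matrix (Fin N) (Fin N) ℂ)ˣ) : Matrix (Fin N) (Fin N) ℂ)‖ ^ 2 ≤ 1 := by
    have := mul_le_mul hWi hWi (norm_nonneg _) zero_le_one
    nlinarith [this, norm_nonneg ((W⁻¹ : (Matrix (Fin N) (Fin N) ℂ)ˣ) : Matrix (Fin N) (Fin N) ℂ)]
  have ha0 : 0 ≤ ‖(W : Matrix (Fin N) (Fin N) ℂ) - 1‖ ^ 2 := sq_nonneg _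
  nlinarith [h1, h2, h3, h4, mul_le_mul_of_nonneg_left hWi2 h5, mul_nonneg ha0 h0]

/-- Cauchy–Schwarz for a finite sum of matrices in the Hilbert–Schmidt size: `Σ_jk|(Σ_{ν} A_ν)_jk|² ≤ d·Σ_ν Σ_jk|(A_ν)_jk|²`. [folklore] -/
theorem sum_norm_sq_sum_le (A : Fin P.d → Matrix (Fin N) (Fin N) ℂ) :
    ∑ j : Fin N, ∑ k : Fin N, ‖(∑ ν : Fin P.d, A ν) j k‖ ^ 2 ≤ P.d * ∑ ν : Fin P.d, ∑ j : Fin N, ∑ k : Fin N, ‖(A ν) j k‖ ^ 2 := by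
  have hcomm : ∑ ν : Fin P.d, ∑ j : Fin N, ∑ k : Fin N, ‖(A ν) j k‖ ^ 2 = ∑ j : Fin N, ∑ k : Fin N, ∑ ν : Fin P.d, ‖(A ν) j k‖ ^ 2 := by
    rw [Finset.sum_comm]; exact Finset.sum_congr rfl fun j _ => Finset.sum_comm
  rw [hcomm, Finset.mul_sum]
  refine Finset.sum_le_sum fun j _ => ?_
  rw [Finset.mul_sum]
  refine Finset.sum_le_sum fun k _ => ?_
  rw [Matrix.sum_apply]
  calc ‖∑ ν : Fin P.d, A ν j k‖ ^ 2 ≤ (∑ ν : Fin P.d, ‖A ν j k‖) ^ 2 :=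
        pow_le_pow_left₀ (norm_nonneg _) (norm_sum_le _ _) 2
    _ ≤ (Finset.univ : Finset (Fin P.d)).card * ∑ ν : Fin P.d, ‖A ν j k‖ ^ 2 := sq_sum_le_card_mul_sum_sq
    _ = P.d * ∑ ν : Fin P.d, ‖A ν j k‖ ^ 2 := by rw [Finset.card_univ, Fintype.card_fin]

/-- ★★★ **B-J2, POINTWISE: THE COVARIANT DERIVATIVE OF THE CURRENT FIELD IS ONE PRINCIPAL TERM PLUS LIVE ERRORS.**  Unitary background; `J` bounds the plaquette field's covariant
codifferences (`‖(D^*_ν U(∂p_{νμ}))(z)‖ ≤ J`, all `ν μ z`; `J := 2a` from PlaqSmall at the member).  Then for every `φ μ κ x`, with `MAIN_{κμ}(x) = Σ_ν (R(V_ν⁺)g⁰ − R(V_ν)g⁰)` (DISPLAYED, B-J3's input):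
`Σ_jk|((D_κ C_μ)(x) + MAIN_{κμ}(x))_jk|² ≤ 8·d²·J²·(Σ_jk|(D_κφ)(x+e_μ)_jk|² + Σ_jk|curl_U(D_Uφ)_{κμ}(x)_jk|²)` — a covariant difference of `φ` and a curvature commutator, NO value of `φ`.
[cite: Balaban1985BackgroundPropagators, (3.8)-(3.9) p.392; Balaban1985RegularSpaces, (1.2) p.76, (1.9) p.77; Balaban1985Variational, (135) p.298, Prop. 7 p.299] -/
theorem sum_norm_sq_covD_currentField_add_main_le [NeZero N]
    (hU : ∀ (ν : Fin P.d) (x : Site P i), (U ν x : Matrix (Fin N) (Fin N) ℂ) ∈ unitary (Matrix (Fin N) (Fin N) ℂ))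
    {J : ℝ} (hJ : ∀ (ν μ : Fin P.d) (z : Site P i), ‖covDstar (torusT P i) U ν (fun w => (plaqU (torusT P i) U ν μ w : Matrix (Fin N) (Fin N) ℂ)) z‖ ≤ J)
    (φ : Site P i → Matrix (Fin N) (Fin N) ℂ) (μ κ : Fin P.d) (x : Site P i) :
    ∑ j : Fin N, ∑ k : Fin N, ‖(covD (torusT P i) U κ (fun z => ∑ ν : Fin P.d,
        (R ((U ν (z.unshift ν))⁻¹ * plaqU (torusT P i) U ν μ (z.unshift ν) * U ν (z.unshift ν))
              (R (U ν (z.unshift ν))⁻¹ (R (U μ (z.unshift ν) * U ν ((z.unshift ν).shift μ)) (φ (((z.unshift ν).shift μ).shift ν))))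
          - R (plaqU (torusT P i) U ν μ z)
              (R (U ν (z.unshift ν))⁻¹ (R (U μ (z.unshift ν) * U ν ((z.unshift ν).shift μ)) (φ (((z.unshift ν).shift μ).shift ν)))))) x
        + ∑ ν : Fin P.d,
          (R (U κ x * (plaqU (torusT P i) U ν μ (x.shift κ)
                  * ((U ν ((x.shift κ).unshift ν))⁻¹ * plaqU (torusT P i) U ν μ ((x.shift κ).unshift ν) * U ν ((x.shift κ).unshift ν))⁻¹) * (U κ x)⁻¹)
                (R (U μ x) (φ (x.shift μ)))
            - R (plaqU (torusT P i) U ν μ x * ((U ν (x.unshift ν))⁻¹ * plaqU (torusT P i) U ν μ (x.unshift ν) * U ν (x.unshift ν))⁻¹)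
                (R (U μ x) (φ (x.shift μ))))) j k‖ ^ 2
      ≤ 8 * (P.d : ℝ) ^ 2 * J ^ 2 * (∑ j : Fin N, ∑ k : Fin N, ‖(covD (torusT P i) U κ φ (x.shift μ)) j k‖ ^ 2
          + ∑ j : Fin N, ∑ k : Fin N, ‖(curl (torusT P i) U (fun κ' => covD (torusT P i) U κ' φ) κ μ x) j k‖ ^ 2) := by
  letI : CStarAlgebra (Matrix (Fin N) (Fin N) ℂ) := B10Eq29TubeLine.cstarAlgebraMatrix N
  rw [covD_currentField_eq, sub_add_cancel]
  -- letters
  set d : Matrix (Fin N) (Fin N) ℂ := covD (torusT P i) U κ (fun z => R (U μ z) (φ (z.shift μ))) x with hd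
  set Vp : Fin P.d → (Matrix (Fin N) (Fin N) ℂ)ˣ := fun ν => U κ x * (plaqU (torusT P i) U ν μ (x.shift κ)
      * ((U ν ((x.shift κ).unshift ν))⁻¹ * plaqU (torusT P i) U ν μ ((x.shift κ).unshift ν) * U ν ((x.shift κ).unshift ν))⁻¹) * (U κ x)⁻¹ with hVp
  have hJ0 : 0 ≤ J := (norm_nonneg _).trans (hJ μ μ x)
  -- each unit `V_ν⁺` is unitary and within `J` of `1`
  have hVpu : ∀ ν, (Vp ν : Matrix (Fin N) (Fin N) ℂ) ∈ unitary (Matrix (Fin N) (Fin N) ℂ) := by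
    intro ν
    simp only [hVp, Units.val_mul]
    exact mul_mem (mul_mem (hU _ _) (V_mem_unitary U hU μ ν (x.shift κ))) (inv_mem_unitary (hU _ _))
  have hVp1 : ∀ ν, ‖(Vp ν : Matrix (Fin N) (Fin N) ℂ) - 1‖ ≤ J := by
    intro ν
    have e : (Vp ν : Matrix (Fin N) (Fin N) ℂ) - 1 = R (U κ x) ((plaqU (torusT P i) U ν μ (x.shift κ)
        * ((U ν ((x.shift κ).unshift ν))⁻¹ * plaqU (torusT P i) U ν μ ((x.shift κ).unshift ν) * U ν ((x.shift κ).unshift ν))⁻¹ :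
          (Matrix (Fin N) (Fin N) ℂ)ˣ) - 1) := by
      rw [hVp, R_sub, B9Eq39Adjoint.R_apply_one, R_def, Units.val_mul, Units.val_mul]
    rw [e]
    refine (B9Eq310Hermitian.norm_R_le (CStarRing.norm_of_mem_unitary (hU κ x)).le
      (CStarRing.norm_of_mem_unitary (inv_mem_unitary (hU κ x))).le _).trans ?_
    exact (norm_V_sub_one_le U hU μ ν (x.shift κ)).trans (hJ ν μ _)
  -- the live sum, term by term
  have hterm : ∀ ν, ∑ j : Fin N, ∑ k : Fin N, ‖(d - R (Vp ν) d) j k‖ ^ 2 ≤ 4 * J ^ 2 * ∑ j : Fin N, ∑ k : Fin N, ‖d j k‖ ^ 2 := by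
    intro ν
    have hneg : ∑ j : Fin N, ∑ k : Fin N, ‖(d - R (Vp ν) d) j k‖ ^ 2 = ∑ j : Fin N, ∑ k : Fin N, ‖(R (Vp ν) d - d) j k‖ ^ 2 := by
      refine Finset.sum_congr rfl fun j _ => Finset.sum_congr rfl fun k _ => ?_
      rw [← norm_neg, ← Matrix.neg_apply, neg_sub]
    rw [hneg]
    refine (sum_norm_sq_R_sub_self_le (hVpu ν) d).trans ?_
    have hd0 : 0 ≤ ∑ j : Fin N, ∑ k : Fin N, ‖d j k‖ ^ 2 := Finset.sum_nonneg fun _ _ => Finset.sum_nonneg fun _ _ => sq_nonneg _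
    have := pow_le_pow_left₀ (norm_nonneg _) (hVp1 ν) 2
    nlinarith [mul_le_mul_of_nonneg_right this hd0]
  -- Cauchy–Schwarz over ν, then the value-free size of `d`
  have hCS := sum_norm_sq_sum_le (P := P) (fun ν => d - R (Vp ν) d)
  have hsum : ∑ ν : Fin P.d, ∑ j : Fin N, ∑ k : Fin N, ‖(d - R (Vp ν) d) j k‖ ^ 2 ≤ P.d * (4 * J ^ 2 * ∑ j : Fin N, ∑ k : Fin N, ‖d j k‖ ^ 2) := by
    calc _ ≤ ∑ _ν : Fin P.d, 4 * J ^ 2 * ∑ j : Fin N, ∑ k : Fin N, ‖d j k‖ ^ 2 := Finset.sum_le_sum fun ν _ => hterm ν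
      _ = _ := by rw [Finset.sum_const, Finset.card_univ, Fintype.card_fin, nsmul_eq_mul]
  have hdle : ∑ j : Fin N, ∑ k : Fin N, ‖d j k‖ ^ 2 ≤ 2 * ∑ j : Fin N, ∑ k : Fin N, ‖(covD (torusT P i) U κ φ (x.shift μ)) j k‖ ^ 2
      + 2 * ∑ j : Fin N, ∑ k : Fin N, ‖(curl (torusT P i) U (fun κ' => covD (torusT P i) U κ' φ) κ μ x) j k‖ ^ 2 := by
    rw [hd, covD_transportedValue_eq]
    refine (sum_norm_sq_add_le _ _).trans ?_
    rw [sum_norm_sq_R (hU μ x)]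
  have hd0 : (0 : ℝ) ≤ P.d := Nat.cast_nonneg _
  have hA : (fun ν => d - R (Vp ν) d) = fun ν => (covD (torusT P i) U κ (fun z => R (U μ z) (φ (z.shift μ))) x
      - R (U κ x * (plaqU (torusT P i) U ν μ (x.shift κ)
          * ((U ν ((x.shift κ).unshift ν))⁻¹ * plaqU (torusT P i) U ν μ ((x.shift κ).unshift ν) * U ν ((x.shift κ).unshift ν))⁻¹) * (U κ x)⁻¹)
        (covD (torusT P i) U κ (fun z => R (U μ z) (φ (z.shift μ))) x)) := by
    funext ν; rw [hd, hVp]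
  have hCS' := hCS
  rw [hA] at hCS'
  refine hCS'.trans ?_
  have h2 := mul_le_mul_of_nonneg_left hsum hd0
  have h3 : (P.d : ℝ) * (P.d * (4 * J ^ 2 * ∑ j : Fin N, ∑ k : Fin N, ‖d j k‖ ^ 2))
      ≤ 8 * (P.d : ℝ) ^ 2 * J ^ 2 * (∑ j : Fin N, ∑ k : Fin N, ‖(covD (torusT P i) U κ φ (x.shift μ)) j k‖ ^ 2
          + ∑ j : Fin N, ∑ k : Fin N, ‖(curl (torusT P i) U (fun κ' => covD (torusT P i) U κ' φ) κ μ x) j k‖ ^ 2) := by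
    have hc : 0 ≤ (P.d : ℝ) * P.d * (4 * J ^ 2) := by positivity
    nlinarith [mul_le_mul_of_nonneg_left hdle hc]
  exact h2.trans h3

end Summit.QuantumFields.YangMills.Theorems.Prop7CurrentFieldLeibniz

end
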